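import Summits.MatrixMultiplication.OmegaCensus.DominoZ5Z5Cover19Defs
import Summits.MatrixMultiplication.OmegaCensus.DominoZ5Z5Data19S0
import HarnessLib

/-!
# Soundness of the line-certificate table for `(1,9,12)@325`, hole class `σ = 0`, part B (directions `2`, `3`)

ω-census `pub-omega`, family (b3), seat pub-omega-group gen 38.  Framing: lottery ticket; floor = certified bounds/negative ranges.
VALUE: kernel computation of the `ℤ₅²` stage of the census cell `(1,9,12)@325` of `ℤ₅ × ℤ₆₅` (design `HOME/pub-omega-group-g37/DESIGN-1-9-12.md`);
NOT progress on ω.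
`soundChk3 5 9 tree19s0 (certAt19 0)` ranges over `6 × 715` (direction, count vector) pairs, each unflagged one looked up linearly in the
`3 415`-entry certificate tables (`table19`, `exrow19`); as ONE `decide + kernel` it exceeds the kernel memory cap (probe, this seat), so it is
computed in `12` pieces (direction × half of `compsLB [] 5 9`), three files of two directions per hole class, and reassembled in part C.

-/

namespace Summit.MatrixMultiplication.OmegaCensus

namespace Z5Z5ThreeSet

open ZpZpDomino

set_option maxRecDepth 100000 in
set_option maxHeartbeats 4000000 in
/-- Soundness piece: direction `2`, first half of the count vectors. [folklore] -/
theorem sound19s0_d2a : (((compsLB [] 5 9).take 358).all fun c =>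
    tree19s0.mem (off 5 10 2 + polyBE 10 c) || certAt19 0 2 c) = true := by decide +kernel

set_option maxRecDepth 100000 in
set_option maxHeartbeats 4000000 in
/-- Soundness piece: direction `2`, second half of the count vectors. [folklore] -/
theorem sound19s0_d2b : (((compsLB [] 5 9).drop 358).all fun c =>
    tree19s0.mem (off 5 10 2 + polyBE 10 c) || certAt19 0 2 c) = true := by decide +kernel

set_option maxRecDepth 100000 in
set_option maxHeartbeats 4000000 in
/-- Soundness piece: direction `3`, first half of the count vectors. [folklore] -/
theorem sound19s0_d3a : (((compsLB [] 5 9).take 358).all fun c =>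
    tree19s0.mem (off 5 10 3 + polyBE 10 c) || certAt19 0 3 c) = true := by decide +kernel

set_option maxRecDepth 100000 in
set_option maxHeartbeats 4000000 in
/-- Soundness piece: direction `3`, second half of the count vectors. [folklore] -/
theorem sound19s0_d3b : (((compsLB [] 5 9).drop 358).all fun c =>
    tree19s0.mem (off 5 10 3 + polyBE 10 c) || certAt19 0 3 c) = true := by decide +kernel

end Z5Z5ThreeSet

end Summit.MatrixMultiplication.OmegaCensus
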